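import Summits.BirchSwinnertonDyer.Rank1Residual.X11b.KolyvaginClassChoiceConcrete
import Summits.BirchSwinnertonDyer.BirchSwinnertonDyer.Theorems.KolyvaginRoadThreePointCertificate
import HarnessLib

/-!
# Crux `JetchevIrreducibleReadingByName` (item 20165, shared K8-t′ / K9), stub S5 — plumbing for the (B)-conjunct: the
# concrete Kolyvagin class at a ZHANG–Kolyvagin level does not depend on the auxiliary choices, up to a unit
# (x11b3's `KolyvaginChoice.kolyvaginClass_eq_smul_of_sameLevel` RE-KEYED from Gross primes to Zhang primes of index `≥ M`)
# — seat `bsd-potss-k8t-c4` g11; `--supports 20165`, helper; route-free; nothing booked, no item closed, BSD is not proved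

WHY. The (B)-conjunct of S5 (v7 candidate `stub_prop47IrredP` = the binder `h47P` of this seat's re-keyed H63 chain):
«`p^j • c_M(mℓ) ∈ Ker_λ ↔ p^j • c_M(m) ∈ Ker_λ`» is asked for an ARBITRARY compatible pair `(d, d')` of the tree's
`KolyvaginHeegnerData` at conductors `m`, `mℓ`. The road to it (this seat g10's FINDING §5; cell `bsd-stepL` corner-p1
g9/g10's Zhang re-key of x11b3's `h44` programme, p530739 / p532010 / p532737) delivers McCallum Prop. 4.4 in ORDER form
for ONE COHERENT FAMILY of data on the divisors of a level (x11b3's `h44_concrete_of_traceRelation_of_congruence` shape).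
Transport from that family to the given pair needs exactly Gross's remark (§4, after (4.1)): the class `c_M(k)` depends on
the generators `σ_q`, the transversal `S` and the embedding `K[k] → K̄` only up to a unit of `ℤ/p^M` — x11b3's
`KolyvaginClassChoiceConcrete` proves it at GROSS primes (`IsKolyvaginPrime ∧ FrobEqFrobInfty`), whose two keyed inputs
(trace membership `Tr_q y ∈ p^M E`, McCallum (4)) use only Zhang's congruences `p^M ∣ q + 1`, `p^M ∣ a_q` — available in
Zhang currency as bsd-stepL zhang3-p1's `KolyCert.…_zhang` certificates. This file is that re-key; with it the pair
statement follows from the family statement by `zsmul_kolyvaginClass_mem_iff_zhang` at both levels (the compatibility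
binders of S5 are then not even needed).

WHAT IS PROVED. `kolyvaginClass_eq_smul_of_sameLevel_zhang`, `zsmul_kolyvaginClass_mem_iff_zhang` — statements of
x11b3's two theorems with the Zhang antecedent, proofs verbatim up to the three keyed calls. Labelled input {`hA`}
(admissibility; on the crux's rows a theorem: `JetchevIrreducibleProp44.isAdmissible_and_mem_invPoints_of_irreducible_of_heegner`).
HONEST FRAMING: plumbing; nothing asserted about any curve; S5, the crux and BSD stay open.

References: [cite: GrossLMS1991, §4 (4.1) and the sentence after it, Prop. 3.6, Prop. 3.7 (1), Lemma 4.3]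
[cite: McCallumLMS1991, §4 (4)–(6), Prop. 4.4] [cite: WZhang2014, Notations (xii)].
-/

set_option autoImplicit false
-- the Theorems directory repeats the summit name (sibling precedent `KatoDescentPotSupersingularAssembly.lean`)
set_option linter.dupNamespace false

noncomputable section

open scoped Classical
open WeierstrassCurve Field NumberField IsDedekindDomain Finset
open Literature.NumberTheory.EllipticCurves Literature.NumberTheory.GaloisRepresentations
open Literature.NumberTheory.EllipticCurves.KolyvaginCocycle
open Literature.NumberTheory.EllipticCurves.KolyvaginEuler
open Literature.NumberTheory.EllipticCurves.RingClassField
open Literature.NumberTheory.EllipticCurves.ModularForms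
open Summit.BirchSwinnertonDyer.Rank1Residual.X11b Summit.BirchSwinnertonDyer.Rank1Residual.X11b.Three
open Summit.BirchSwinnertonDyer.Rank1Residual.X11b.KolyvaginChoice

namespace Summit.BirchSwinnertonDyer.BirchSwinnertonDyer.Theorems.JetchevIrreducibleProp44

-- `K : Type`: the tree's ring-class class field theory is universe `0`.
variable {K : Type} [Field K] [NumberField K] {N : ℕ} {W : WeierstrassCurve ℚ}

/-- **Gross 1991, §4 (after (4.1)) for the tree's CONCRETE classes at ZHANG–Kolyvagin levels: choice-independence
up to a unit.** x11b3's `KolyvaginChoice.kolyvaginClass_eq_smul_of_sameLevel` with the antecedent «Gross primes»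
(`IsKolyvaginPrime ∧ FrobEqFrobInfty W K (p^M)`) replaced by «Zhang primes of index `≥ M`»
(`Zhang2014.IsKolyvaginPrime N W K p q ∧ M ≤ Zhang2014.kolyvaginIndex W p q`, image-free): for a family `d` of
data at the divisors of a square-free such level `n`, `k ∣ n`, and ANY second datum `d'` at level `k`,
`∃ u` prime to `p` with `c'_M(k) = u • c_M(k)`, labelled input {`hA`}. Proof = x11b3's verbatim, the two Gross-keyed
inputs (Prop. 3.7 (1) trace membership, McCallum (4) invariance) fed by bsd-stepL zhang3-p1's Zhang certificates
`KolyCert.grAct_traceElt_mem_of_dvd_zhang` / `KolyCert.kolyvaginPoint_mem_invPoints_of_dvd_zhang`, and `p^M ∣ q + 1`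
from `Zhang2014.le_kolyvaginIndex_iff`. [cite: GrossLMS1991, §4 (4.1), Prop. 3.6, Lemma 4.3]
[cite: McCallumLMS1991, §4 (4)–(6)] [cite: WZhang2014, Notations (xii)] -/
theorem kolyvaginClass_eq_smul_of_sameLevel_zhang [NeZero N] [W.IsElliptic] [W.IsGloballyMinimal]
    (hK : IsImaginaryQuadratic K) (ι : K →+* ℂ) (Dt : ModularParametrizationData W N) {β : ℤ}
    {p M : ℕ} (hp : p.Prime) (hM : 1 ≤ M)
    (hND : IsCoprime (N : ℤ) (NumberField.discr K)) (hD : NumberField.discr K < -4)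
    {n : ℕ} (hn : Squarefree n)
    (hKol : ∀ q ∈ n.primeFactors,
      Zhang2014.IsKolyvaginPrime N W K p q ∧ M ≤ Zhang2014.kolyvaginIndex W p q)
    (d : (m : ℕ) → m ∣ n → KolyvaginHeegnerData Dt β ι m) {k : ℕ} (hk : k ∣ n)
    (d' : KolyvaginHeegnerData Dt β ι k)
    (hA : IsAdmissible (absoluteGaloisGroup K) (d k hk).pointsSubgroup ((p ^ M : ℕ) : ℤ)) :
    ∃ u : ℤ, IsCoprime u (p : ℤ) ∧
      d'.kolyvaginClass hp M = u • (d k hk).kolyvaginClass hp M := by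
  have hn0 : n ≠ 0 := Squarefree.ne_zero hn
  have hk0 : k ≠ 0 := ne_zero_of_dvd_ne_zero hn0 hk
  have hksq : Squarefree k := hn.squarefree_of_dvd hk
  have hinert : ∀ q ∈ n.primeFactors, (Ideal.span {(q : 𝓞 K)}).IsPrime :=
    fun q hq ↦ (hKol q hq).1.2.2.2.2.1
  have hdiv : ∀ Q : geomPoints (W.baseChange K), ∃ R, ((p ^ M : ℕ) : ℤ) • R = Q :=
    (W.baseChange K).zsmul_geomPoints_surjective_of_charZero
      (by exact_mod_cast pow_ne_zero M hp.ne_zero)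
  -- level data for the family `d` (x11b3-p2 `exists_levelData`): `σ_m`, `y_m`, `π_m`, `j_m`, `e_m`
  choose σ H₀ f₀ y π j e hord hj hπρ hfsec₀ hHρ₀ hdict hjunk using
    fun m ↦ KolyvaginH44.exists_levelData (W := W) (Dt := Dt) (β := β) hK ι hn hinert d m
  -- `𝒢_m = ringClassGal ι m` is a finite commutative group acting on `E(K[m])` through `pointGalHom`
  letI hcg : ∀ m, CommGroup (ringClassGal ι m) := fun m ↦
    { (inferInstance : Group (ringClassGal ι m)) with
      mul_comm := fun a b ↦ (KolyvaginH44.isMulCommutative_ringClassGal' hK ι m).is_comm.comm a b }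
  haveI hfin : ∀ m, Finite (ringClassGal ι m) := KolyvaginH44.finite_ringClassGal hK ι
  letI act : ∀ m, DistribMulAction (ringClassGal ι m)
      ((W.baseChange (ringClassField K ι m)).toAffine.Point) := fun m ↦
    DistribMulAction.compHom _ ((pointGalHom W (ringClassField K ι m)).comp (ringClassGal ι m).subtype)
  have hsmul : ∀ (m) (g : ringClassGal ι m) (Q : (W.baseChange (ringClassField K ι m)).toAffine.Point),
      g • Q = pointGalHom W (ringClassField K ι m)
        (g : ringClassField K ι m ≃ₐ[ℚ] ringClassField K ι m) Q := fun _ _ _ ↦ rfl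
  -- the inclusion `ρ_m : 𝒢_m ≤ Aut_ℚ(K[m])`
  set ρ : ∀ m, ringClassGal ι m →* (ringClassField K ι m ≃ₐ[ℚ] ringClassField K ι m) :=
    fun m ↦ (ringClassGal ι m).subtype with hρdef
  have hρ : ∀ m, Function.Injective (ρ m) := fun m ↦ (ringClassGal ι m).subtype_injective
  -- the subgroup `H_m = Gal(K[m]/K[1])` pulled back to `𝒢_m`, and sections valued in the transversals
  set Hc : ∀ m, Subgroup (ringClassGal ι m) :=
    fun m ↦ (ringClassGalOver ι m 1).comap (ringClassGal ι m).subtype with hHc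
  letI hft : ∀ m, Fintype (ringClassGal ι m ⧸ Hc m) := fun m ↦ Fintype.ofFinite _
  have hHρ : ∀ m : ℕ, m ∣ n → ∀ h ∈ Hc m, ρ m h ∈ ringClassGalOver ι m 1 :=
    fun m _ h hh ↦ Subgroup.mem_comap.mp hh
  have hsec : ∀ m, ∃ fm : ringClassGal ι m ⧸ Hc m → ringClassGal ι m,
      (∀ c, (fm c : ringClassGal ι m ⧸ Hc m) = c) ∧
        ∀ hm : m ∣ n, ∀ c,
          (fm c : ringClassField K ι m ≃ₐ[ℚ] ringClassField K ι m) ∈ (d m hm).S := by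
    intro m
    by_cases hm : m ∣ n
    · obtain ⟨fm, h1, h2⟩ := (d m hm).exists_section_of_transversal
      exact ⟨fm, h1, fun _ ↦ h2⟩
    · exact ⟨fun c ↦ c.out, fun c ↦ QuotientGroup.out_eq' c, fun h ↦ (hm h).elim⟩
  choose f hfsec hfS using hsec
  obtain ⟨f', hf'sec, hf'S⟩ := d'.exists_section_of_transversal
  -- the dictionary at the divisors
  have hσA : ∀ (m : ℕ) (hm : m ∣ n), ∀ q ∈ m.primeFactors, ρ m (σ m q) = (d m hm).σ q :=
    fun m hm ↦ (hdict m hm).2.2.1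
  have hyA : ∀ (m : ℕ) (hm : m ∣ n), AddEquiv.refl _ (y m) = (d m hm).y :=
    fun m hm ↦ (hdict m hm).2.1
  have hjd : ∀ (m : ℕ) (hm : m ∣ n), j m = (d m hm).toGeomPoints := fun m hm ↦ (hdict m hm).1
  have hj' : ∀ (m) (g : absoluteGaloisGroup K) (a : (W.baseChange (ringClassField K ι m)).toAffine.Point),
      j m (π m g • a) = g • j m a := fun m g a ↦ by rw [hsmul]; exact hj m g a
  have hiA : ∀ (m : ℕ), m ∣ n → ∀ (g : ringClassGal ι m)
      (a : (W.baseChange (ringClassField K ι m)).toAffine.Point),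
      AddEquiv.refl _ (g • a) = pointGalHom W (ringClassField K ι m) (ρ m g) (AddEquiv.refl _ a) :=
    fun m _ g a ↦ hsmul m g a
  -- x11b3-p4's Prop. 3.6 package at the divisor `k`: `hgen`, `htr`, `hPt`
  have hgen : Hc k ≤ Subgroup.closure (σ k '' ((k.primeFactors : Finset ℕ) : Set ℕ)) :=
    KolyvaginH44.le_closure_of_dvd hK ι Dt hn d σ (fun m ↦ m.primeFactors) Hc ρ hρ hσA
      (fun _ _ ↦ rfl) hHρ k hk
  have htr : ∀ ℓ ∈ k.primeFactors, grAct _ (traceElt (σ k ℓ) ℓ) (y k) ∈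
      zsmulRange ((W.baseChange (ringClassField K ι k)).toAffine.Point) ((p ^ M : ℕ) : ℤ) :=
    KolyCert.grAct_traceElt_mem_of_dvd_zhang hK ι Dt hp hND hD hn hKol d σ (fun m ↦ m.primeFactors)
      y ρ (fun _ ↦ AddEquiv.refl _) hiA hyA hσA (fun _ _ ↦ rfl) k hk
  have hPt : j k (kolyvaginPoint (σ k) k.primeFactors (f k) (y k)) ∈
      invPoints (absoluteGaloisGroup K) (j k).range ((p ^ M : ℕ) : ℤ) :=
    KolyCert.kolyvaginPoint_mem_invPoints_of_dvd_zhang hK ι Dt hp hND hD hn hKol d σ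
      (fun m ↦ m.primeFactors) Hc f y π j hj' ρ hρ (fun _ ↦ AddEquiv.refl _) hiA hyA hσA
      (fun _ _ ↦ rfl) (fun m _ ↦ hfsec m) hHρ k hk
  -- `p^M ∣ q + 1`, `q ≠ 0`, `orderOf σ_q = q + 1` on the prime factors of `k`
  have hdvd : ∀ ℓ ∈ k.primeFactors, ((p ^ M : ℕ) : ℤ) ∣ ((ℓ + 1 : ℕ) : ℤ) := by
    intro ℓ hℓ
    obtain ⟨-, hℓM⟩ := hKol ℓ (Nat.primeFactors_mono hk hn0 hℓ)
    haveI : Fact p.Prime := ⟨hp⟩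
    exact_mod_cast (Zhang2014.le_kolyvaginIndex_iff.mp hℓM).1
  have hL : ∀ ℓ ∈ k.primeFactors, ℓ ≠ 0 := fun ℓ hℓ ↦ (Nat.prime_of_mem_primeFactors hℓ).ne_zero
  have horder : ∀ ℓ ∈ k.primeFactors, orderOf (σ k ℓ) = ℓ + 1 := by
    intro ℓ hℓ
    obtain ⟨hℓp, hℓk, -⟩ := Nat.mem_primeFactors.mp hℓ
    have hℓk' : ¬ ℓ ∣ k / ℓ := KolyvaginH44.not_dvd_div_of_squarefree_of_prime hksq hℓp hℓk
    rw [← orderOf_injective (ρ k) (hρ k) (σ k ℓ), hσA k hk ℓ hℓ]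
    exact RingClassTower.orderOf_eq_succ_of_zpowers_eq_ringClassGalOver hK ι hℓp
      (hinert ℓ (Nat.primeFactors_mono hk hn0 hℓ)) hℓk hℓk' hk0 (Or.inr hD) ((d k hk).zpowers_σ ℓ hℓ)
  -- the second datum's generators, inside `𝒢_k`
  have hσ'mem : ∀ q ∈ k.primeFactors, d'.σ q ∈ ringClassGal ι k := fun q hq ↦
    ringClassGalOver_le_ringClassGal ι k (k / q) ((d'.zpowers_σ q hq) ▸ Subgroup.mem_zpowers _)
  let σ' : ℕ → ringClassGal ι k := fun q ↦
    if hq : q ∈ k.primeFactors then ⟨d'.σ q, hσ'mem q hq⟩ else 1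
  have hσ'A : ∀ q ∈ k.primeFactors,
      ρ k (σ' q) = d'.σ q := fun q hq ↦ by
    simp only [σ', dif_pos hq]
    rfl
  have hz : ∀ ℓ ∈ k.primeFactors, Subgroup.zpowers (σ' ℓ) = Subgroup.zpowers (σ k ℓ) := by
    intro ℓ hℓ
    apply Subgroup.map_injective (hρ k)
    rw [MonoidHom.map_zpowers, MonoidHom.map_zpowers, hσ'A ℓ hℓ, hσA k hk ℓ hℓ, d'.zpowers_σ ℓ hℓ,
      (d k hk).zpowers_σ ℓ hℓ]
  -- FILE A: `P'(k) − u · P(k) ∈ p^M E(K[k])`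
  obtain ⟨u, hu, hmem⟩ := exists_isCoprime_kolyvaginPoint_sub_smul_mem (hfsec k) hf'sec hgen hL
    horder hz hdvd htr
  -- G1: the abstract Kolyvagin points ARE `P(k)`, `P'(k)` (x11b3-p8's bridge)
  have hbij := KolyvaginH37Bridge.bijOn_of_section_of_transversal (ρ k) (hρ k)
    (H := Hc k) (Γ := ringClassGal ι k) (G₁ := ringClassGalOver ι k 1) (hHρ k hk)
    (S := ((d k hk).S : Set _)) (fun s hs ↦ (d k hk).S_subset s hs)
    (fun s hs ↦ ⟨⟨s, (d k hk).S_subset s hs⟩, rfl⟩) (d k hk).S_transversal (f k) (hfsec k) (hfS k hk)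
  have hbij' := KolyvaginH37Bridge.bijOn_of_section_of_transversal (ρ k) (hρ k)
    (H := Hc k) (Γ := ringClassGal ι k) (G₁ := ringClassGalOver ι k 1) (hHρ k hk)
    (S := (d'.S : Set _)) (fun s hs ↦ d'.S_subset s hs)
    (fun s hs ↦ ⟨⟨s, d'.S_subset s hs⟩, rfl⟩) d'.S_transversal f' hf'sec hf'S
  have hyk : y k = (d k hk).y := hyA k hk
  have hyk' : y k = d'.y := by rw [hyk, y_eq (d k hk) d']
  have hP : kolyvaginPoint (σ k) k.primeFactors (f k) (y k) = (d k hk).derivedPoint := by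
    rw [hyk]
    exact KolyvaginH37Bridge.map_kolyvaginPoint_eq_derivedPoint
      (pointGalHom W (ringClassField K ι k)) (ρ k) (AddMonoidHom.id _) (fun g a ↦ hsmul k g a)
      hksq (hσA k hk) (f k) hbij (d k hk).y
  have hP' : kolyvaginPoint σ' k.primeFactors f' (y k) = d'.derivedPoint := by
    rw [hyk']
    exact KolyvaginH37Bridge.map_kolyvaginPoint_eq_derivedPoint
      (pointGalHom W (ringClassField K ι k)) (ρ k) (AddMonoidHom.id _) (fun g a ↦ hsmul k g a)
      hksq hσ'A f' hbij' d'.y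
  -- `P'(k) = u • P(k) + p^M • b` in `E(K[k])`, pushed to `E(K̄)` along `J = (d k hk).toGeomPoints`
  obtain ⟨b, hb⟩ := mem_zsmulRange_iff.mp hmem
  rw [hP, hP'] at hb
  have hcongE : d'.derivedPoint = u • (d k hk).derivedPoint + ((p ^ M : ℕ) : ℤ) • b := by
    rw [hb]; abel
  have hJcong : (d k hk).toGeomPoints d'.derivedPoint =
      u • (d k hk).toGeomPoints (d k hk).derivedPoint + ((p ^ M : ℕ) : ℤ) • (d k hk).toGeomPoints b := by
    rw [hcongE, map_add, map_zsmul, map_zsmul]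
  have hJb : (d k hk).toGeomPoints b ∈ (d k hk).pointsSubgroup := ⟨b, rfl⟩
  have hPtJ : (d k hk).toGeomPoints (d k hk).derivedPoint ∈
      invPoints (absoluteGaloisGroup K) (d k hk).pointsSubgroup ((p ^ M : ℕ) : ℤ) := by
    have h := hPt
    rw [hP, hjd k hk] at h
    exact h
  have hPtJ' : (d k hk).toGeomPoints d'.derivedPoint ∈
      invPoints (absoluteGaloisGroup K) (d k hk).pointsSubgroup ((p ^ M : ℕ) : ℤ) := by
    rw [hJcong]
    exact (invPoints _ _ _).add_mem ((invPoints _ _ _).zsmul_mem hPtJ u) (zsmul_mem_invPoints hA hJb)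
  -- McCallum's class is additive: `c(u P + p^M b) = u c(P)`
  have hcls : kolyvaginClass (W.baseChange K) ((p ^ M : ℕ) : ℤ) hdiv hA
        ((d k hk).toGeomPoints d'.derivedPoint) hPtJ' =
      u • kolyvaginClass (W.baseChange K) ((p ^ M : ℕ) : ℤ) hdiv hA
        ((d k hk).toGeomPoints (d k hk).derivedPoint) hPtJ := by
    set P₀ := (d k hk).toGeomPoints (d k hk).derivedPoint with hP₀
    set B₀ := (d k hk).toGeomPoints b with hB₀
    set Q := Classical.choose (hdiv P₀) with hQdef
    have hQ : ((p ^ M : ℕ) : ℤ) • Q = P₀ := Classical.choose_spec (hdiv P₀)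
    have hεP : u • P₀ ∈ invPoints (absoluteGaloisGroup K) (d k hk).pointsSubgroup ((p ^ M : ℕ) : ℤ) :=
      (invPoints _ _ _).zsmul_mem hPtJ u
    have hεQ : ((p ^ M : ℕ) : ℤ) • (u • Q) = u • P₀ := by rw [smul_comm, hQ]
    have hP'' : u • P₀ + ((p ^ M : ℕ) : ℤ) • B₀ ∈
        invPoints (absoluteGaloisGroup K) (d k hk).pointsSubgroup ((p ^ M : ℕ) : ℤ) := by
      rw [← hJcong]; exact hPtJ'
    have hQ'' : ((p ^ M : ℕ) : ℤ) • (u • Q + B₀) = u • P₀ + ((p ^ M : ℕ) : ℤ) • B₀ := by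
      rw [zsmul_add, hεQ]
    have h1 : kolyvaginClass (W.baseChange K) ((p ^ M : ℕ) : ℤ) hdiv hA
          ((d k hk).toGeomPoints d'.derivedPoint) hPtJ' =
        cls hA (continuous_smul_geomPoints _) hP'' hQ'' := by
      have hQ''' : ((p ^ M : ℕ) : ℤ) • (u • Q + B₀) = (d k hk).toGeomPoints d'.derivedPoint := by
        rw [hQ'', hJcong]
      rw [kolyvaginClass_eq_cls hA hPtJ' hQ''']
      exact cls_congr hA _ hJcong rfl
    rw [h1, cls_add_zsmul hA _ hεP hεQ hJb hP'' hQ'', cls_zsmul hA _ hPtJ hQ u hεP hεQ,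
      kolyvaginClass_eq_cls hA hPtJ hQ]
  -- the embeddings differ by `γ ∈ Γ_K`; same image; `c(γ • P) = c(P)`
  obtain ⟨γ, hγ⟩ := exists_toGeomPoints_eq_smul (d k hk) d'
  have hAeq : d'.pointsSubgroup = (d k hk).pointsSubgroup := pointsSubgroup_eq hK (d k hk) d'
  have hA' : IsAdmissible (absoluteGaloisGroup K) d'.pointsSubgroup ((p ^ M : ℕ) : ℤ) := hAeq ▸ hA
  have hPtγ : γ • (d k hk).toGeomPoints d'.derivedPoint ∈
      invPoints (absoluteGaloisGroup K) (d k hk).pointsSubgroup ((p ^ M : ℕ) : ℤ) :=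
    smul_mem_invPoints hA γ hPtJ'
  have hPt' : d'.toGeomPoints d'.derivedPoint ∈
      invPoints (absoluteGaloisGroup K) d'.pointsSubgroup ((p ^ M : ℕ) : ℤ) := by
    rw [hγ, hAeq]; exact hPtγ
  refine ⟨u, ?_, ?_⟩
  · have hu' : IsCoprime u ((p : ℤ) ^ M) := by exact_mod_cast hu
    exact (IsCoprime.pow_right_iff hM).mp hu'
  · rw [d'.kolyvaginClass_of_admissible hp M hA' hPt',
      (d k hk).kolyvaginClass_of_admissible hp M hA hPtJ,
      KolyvaginH44.kolyvaginClass_congr (hdiv' := hdiv) (hA' := hA) (hP' := hPtγ) hAeq (hγ _),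
      kolyvaginClass_smul_eq hA γ hPtJ' hPtγ, hcls]

/-- **Membership of the multiples of the concrete class is blind to the auxiliary choices, at Zhang–Kolyvagin
levels**: `t • c'_M(k) ∈ H ↔ t • c_M(k) ∈ H` for every subgroup `H` of `H¹(K, E[p^M])` (the two classes differ by a
unit of `ℤ/p^M`). x11b3's `zsmul_kolyvaginClass_mem_iff`, Zhang-keyed. Same labelled input {`hA`}.
[cite: GrossLMS1991, §4 (4.1)] [cite: McCallumLMS1991, §4 (4)–(6), Prop. 4.4] -/
theorem zsmul_kolyvaginClass_mem_iff_zhang [NeZero N] [W.IsElliptic] [W.IsGloballyMinimal]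
    (hK : IsImaginaryQuadratic K) (ι : K →+* ℂ) (Dt : ModularParametrizationData W N) {β : ℤ}
    {p M : ℕ} (hp : p.Prime) (hM : 1 ≤ M)
    (hND : IsCoprime (N : ℤ) (NumberField.discr K)) (hD : NumberField.discr K < -4)
    {n : ℕ} (hn : Squarefree n)
    (hKol : ∀ q ∈ n.primeFactors,
      Zhang2014.IsKolyvaginPrime N W K p q ∧ M ≤ Zhang2014.kolyvaginIndex W p q)
    (d : (m : ℕ) → m ∣ n → KolyvaginHeegnerData Dt β ι m) {k : ℕ} (hk : k ∣ n)
    (d' : KolyvaginHeegnerData Dt β ι k)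
    (hA : IsAdmissible (absoluteGaloisGroup K) (d k hk).pointsSubgroup ((p ^ M : ℕ) : ℤ))
    (H : AddSubgroup (galH1Torsion (W.baseChange K) ((p ^ M : ℕ) : ℤ))) (t : ℤ) :
    t • d'.kolyvaginClass hp M ∈ H ↔ t • (d k hk).kolyvaginClass hp M ∈ H := by
  obtain ⟨u, hu, he⟩ := kolyvaginClass_eq_smul_of_sameLevel_zhang hK ι Dt hp hM hND hD hn hKol d hk d' hA
  have hu' : IsCoprime u ((p ^ M : ℕ) : ℤ) := by
    rw [Nat.cast_pow]
    exact (IsCoprime.pow_right_iff hM).mpr hu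
  exact zsmul_mem_iff_of_isCoprime hu' (zsmul_galH1Torsion_eq_zero (W.baseChange K) _ _) he t

end Summit.BirchSwinnertonDyer.BirchSwinnertonDyer.Theorems.JetchevIrreducibleProp44

end
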